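import Literature.MathematicalPhysics.QuantumFieldTheory.Balaban1983to89.B9PinCarriersKLevelV1

/-!
# `Balaban1983to89.B9PinCarriersNonVacuity` — Stage-3′(Y) bundle `carriersY`: NODE 00's `U = 1` readings are NONNEGATIVE functionals, hence the ZERO operator layer sits
# below them, and ALL displayed hypotheses of `B9PinCarriersKLevelV1.b9LeafX_carriersY` (interface, residual entries, Sect. B step, gauge reduction, the sixteen leaves)
# are JOINTLY SATISFIABLE over the REAL geometry — A5 certificate of the knit at the bundle; the ∃-dual is junk-inhabited, so no consumer may read content into an `∃ ops` form

B9 = T. Bałaban, *Propagators for lattice gauge theories in a background field*, Commun. Math. Phys. **99** (1985) 389–434 [Balaban1985BackgroundPropagators];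
[4] = [Balaban1984PropagatorsII].  pub-ymgap Track A, node N06; seat `pub-ymgap-dag-n06-a` g3 = «def-Y».  THEOREMS ONLY; count-neutral; nothing of print asserted.

WHAT IS PROVED.
* §1 NODE 00's `U = 1` readings of [4]'s functionals on the k-level torus of record are ≥ 0: T8's torus-site functionals `KTIdx.gp.e` (sups of `|G′λ|`, …), `hHTP`
  (sups of Hölder quotients `hqTP ≥ 0`), hence `Node00.GpU` (`GpU_e_nonneg`, `GpU_h1_nonneg`); r03's fine-bond functionals `supIn`, `holderQ`, `l2Of`, hence `Node00.GU`
  (`GU_e∕h1∕e4∕h2∕l2_nonneg`) — every one a supremum ∕ `L²`-norm of absolute values.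
* §2 `exists_ops_interface` — for every member there is an operator layer (the ZERO layer: all functionals `0`, all predicates `True`, all kernels `0`) satisfying the
  eight `U = 1` comparisons against `GpU`∕`CinvU`∕`GU` and the null readings `hE4`∕`hH2` of `b9LeafX_carriersY`: the bundle's interface to NODE 00 is consistent
  (and junk-satisfiable — the content of N06 is in the sixteen leaves AT GENUINE operators, never in an `∃ ops`).
* §3 (private) the sixteen leaf shapes, the residual entry blocks, «Theorems 3.1–3.3 hold», (3.133), (3.49), Thm 3.14's local blocks at the zero operators over ANY
  geometry with the sign schema `ModelSignsOn`: every clause is `0 ≤` a product of nonnegative geometric quantities.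
* §4 **`exists_ops_b9LeafX`** — THE A5 CERTIFICATE FOR `b9LeafX_carriersY`: at the zero layer ALL its displayed hypotheses hold over the REAL geometry `geo9Y`∕`bg9Y`
  (sign facts = dag-n03-b's `modelSignsOn_geo9K`; the gauge reduction VACUOUSLY by `not_inCubeY`), so, given the [B6] block at NODE 00's tower block of record,
  `B9LeafX (carriersY 𝔸 G ops₀)` is inhabited — the knit at the bundle is not an ex-falso shell, and the leaf at the bundle is junk-inhabitable until `ops` are genuine.
HONEST SCOPE: sign bookkeeping; no estimate; one finite lattice programme; NOT continuum ∕ OS ∕ mass gap ∕ Clay.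
-/

noncomputable section

namespace Literature.MathematicalPhysics.QuantumFieldTheory.Balaban1983to89.B9PinCarriersNonVacuity

open DagBinding
open B6KLevelCensusIndexV1 (KIdx)
open B6Prop22KLevelTorusCensus (KTIdx)
open B6Prop22KLevelTorusCensusEta (gpTP hHTP hqTP hqTP_nonneg)
open B6Prop26Census2136KLevelV1 (kG supIn holderQ l2Of)
open B9PinMembersKLevelV1 (MemberY geo9Y bg9Y)
open B9PinCarriersKLevelV1 (OperatorLayerY carriersY)

variable {d ℓ : ℕ} {hd : 1 ≤ d + 1} {hL : Odd (ℓ + 1) ∧ 1 < ℓ + 1} {b₀ b₁ : ℝ} {Mstar : ℕ}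

/-! ## §1 NODE 00's `U = 1` readings are nonnegative -/

/-- T8's torus-site functionals `e_m` of (2.67) (sups of `|G′λ|`, `|∂G′λ|`, `|G′∂ᵀλ|`, `|ΔG′λ|` over a block) are ≥ 0. [cite: Balaban1984PropagatorsII, Prop. 2.2 (2.67) p.234 (bookkeeping: sups of absolute values)] -/
theorem gp_e_nonneg (i : KTIdx d ℓ) (m : Fin 4) (f : ↥(i.XB) → ℝ) (s : ↥(B6Geom246MultiLevelBox.bset i.D.toDomains)) : 0 ≤ i.gp.e m f s := by
  fin_cases m <;> exact Real.iSup_nonneg fun _ => by split_ifs <;> simp [abs_nonneg]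

/-- T8's Hölder functional `hHTP` (a sup of `hqTP ≥ 0`) is ≥ 0. [cite: Balaban1984PropagatorsII, Prop. 2.2 (2.67) p.234 («‖ζ∇G′λ‖_α»; bookkeeping)] -/
theorem hHTP_nonneg (i : KTIdx d ℓ) (f : ↥(i.XB) → ℝ) (α : ℝ) (ζ : ↥(i.XB) → ℝ) : 0 ≤ hHTP i f α ζ :=
  Real.iSup_nonneg fun p => by split_ifs <;> exact hqTP_nonneg i α _

/-- T8's functionals in print's units (`gpTP`) are ≥ 0. [cite: Balaban1984PropagatorsII, Prop. 2.2 (2.67) p.234 (bookkeeping)] -/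
theorem gpTP_e_nonneg (i : KTIdx d ℓ) (m : Fin 4) (f : ↥(i.XB) → ℝ) (s : ↥(B6Geom246MultiLevelBox.bset i.D.toDomains)) : 0 ≤ (gpTP i).e m f s :=
  mul_nonneg (pow_nonneg (inv_nonneg.2 (Nat.cast_nonneg _)) _) (gp_e_nonneg i m f s)

/-- **`Node00.GpU`'s sup entries are ≥ 0** (T8's functionals on the site summand, `0` on the bond summand). [cite: Balaban1984PropagatorsII, Prop. 2.2 (2.67) p.234 (bookkeeping)] -/
theorem GpU_e_nonneg (i : KIdx d ℓ hd hL b₀ b₁) (n : Fin 4) (lam : Node00.KLoc i) (b : (Node00.kGeoU i).Site) : 0 ≤ (Node00.GpU i).e n lam b := by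
  cases lam with
  | inl f => exact gpTP_e_nonneg _ n f _
  | inr J => exact le_rfl

/-- **`Node00.GpU`'s Hölder entries are ≥ 0**. [cite: Balaban1984PropagatorsII, Prop. 2.2 (2.67) p.234 (bookkeeping)] -/
theorem GpU_h1_nonneg (i : KIdx d ℓ hd hL b₀ b₁) (lam : Node00.KLoc i) (β : ℝ) (ζ : Node00.KCut i) : 0 ≤ (Node00.GpU i).h1 lam β ζ := by
  cases lam with
  | inl f =>
    cases ζ with
    | inl z => exact hHTP_nonneg _ f β z
    | inr z => exact le_rfl
  | inr J =>
    cases ζ with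
    | inl z => exact le_rfl
    | inr z => exact le_rfl

/-- r03's block sup `supIn` is ≥ 0. [cite: Balaban1984PropagatorsII, Prop. 2.6 (2.136) p.247 (bookkeeping: a sup of absolute values)] -/
theorem supIn_nonneg (i : KIdx d ℓ hd hL b₀ b₁) (y : (B6Geom246MultiLevelTorus.geomT i.D).Site)
    (f : PBond (B6GlobalChartV1.PV d ℓ i.m i.K hd hL) 0 → ℝ) : 0 ≤ supIn i y f :=
  Real.iSup_nonneg fun _ => abs_nonneg _

/-- r03's Hölder quotient `holderQ` is ≥ 0. [cite: Balaban1984PropagatorsII, (2.137) p.247 (bookkeeping)] -/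
theorem holderQ_nonneg (i : KIdx d ℓ hd hL b₀ b₁) (α : ℝ) (ζ f : PBond (B6GlobalChartV1.PV d ℓ i.m i.K hd hL) 0 → ℝ) : 0 ≤ holderQ i α ζ f := by
  classical
  exact Real.iSup_nonneg fun q => by
    split_ifs
    · exact mul_nonneg (Real.rpow_nonneg (mul_nonneg (Nat.cast_nonneg _) (inv_nonneg.2 (abs_nonneg _))) _) (abs_nonneg _)
    · exact le_rfl

/-- r03's flat `L²` functional `l2Of` is ≥ 0. [cite: Balaban1984PropagatorsII, (2.140) p.247 (bookkeeping)] -/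
theorem l2Of_nonneg {X : Type*} [Fintype X] (h f : X → ℝ) : 0 ≤ l2Of h f := Real.sqrt_nonneg _

/-- **`Node00.GU`'s entries `e n` are ≥ 0** (r03's functionals on the bond summand, `0` on the site summand). [cite: Balaban1984PropagatorsII, Prop. 2.6 (2.136) p.247 (bookkeeping)] -/
theorem GU_e_nonneg (i : KIdx d ℓ hd hL b₀ b₁) (n : Fin 4) (lam : Node00.KLoc i) (b : (Node00.kGeoU i).Site) : 0 ≤ (Node00.GU i).e n lam b := by
  cases lam with
  | inl f => exact le_rfl
  | inr J =>
    show 0 ≤ (kG i).e n J _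
    fin_cases n
    · exact supIn_nonneg i _ _
    · exact Real.iSup_nonneg fun _ => supIn_nonneg i _ _
    · exact Real.iSup_nonneg fun _ => supIn_nonneg i _ _
    · exact supIn_nonneg i _ _

/-- `Node00.GU`'s `h1` is ≥ 0. [cite: Balaban1984PropagatorsII, (2.137) p.247 (bookkeeping)] -/
theorem GU_h1_nonneg (i : KIdx d ℓ hd hL b₀ b₁) (lam : Node00.KLoc i) (β : ℝ) (ζ : Node00.KCut i) : 0 ≤ (Node00.GU i).h1 lam β ζ := by
  cases lam with
  | inl f => cases ζ <;> exact le_rfl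
  | inr J =>
    cases ζ with
    | inl z => exact le_rfl
    | inr z =>
      show 0 ≤ (kG i).h1 J β z
      exact le_max_of_le_left (Real.iSup_nonneg fun _ => holderQ_nonneg i _ _ _)

/-- `Node00.GU`'s `e4` is ≥ 0. [cite: Balaban1984PropagatorsII, (2.138) p.247 (bookkeeping)] -/
theorem GU_e4_nonneg (i : KIdx d ℓ hd hL b₀ b₁) (lam : Node00.KLoc i) (b : (Node00.kGeoU i).Site) : 0 ≤ (Node00.GU i).e4 lam b := by
  cases lam with
  | inl f => exact le_rfl
  | inr J =>
    show 0 ≤ (kG i).e4 J _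
    exact Real.iSup_nonneg fun _ => Real.iSup_nonneg fun _ => supIn_nonneg i _ _

/-- `Node00.GU`'s `h2` is ≥ 0. [cite: Balaban1984PropagatorsII, (2.139) p.247 (bookkeeping)] -/
theorem GU_h2_nonneg (i : KIdx d ℓ hd hL b₀ b₁) (lam : Node00.KLoc i) (β : ℝ) (ζ : Node00.KCut i) : 0 ≤ (Node00.GU i).h2 lam β ζ := by
  cases lam with
  | inl f => cases ζ <;> exact le_rfl
  | inr J =>
    cases ζ with
    | inl z => exact le_rfl
    | inr z =>
      show 0 ≤ (kG i).h2 J β z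
      exact Real.iSup_nonneg fun _ => Real.iSup_nonneg fun _ => holderQ_nonneg i _ _ _

/-- `Node00.GU`'s `L²` entries are ≥ 0. [cite: Balaban1984PropagatorsII, (2.140) p.247 (bookkeeping)] -/
theorem GU_l2_nonneg (i : KIdx d ℓ hd hL b₀ b₁) (n : Fin 6) (lam : Node00.KLoc i) (h : Node00.KCut i) : 0 ≤ (Node00.GU i).l2 n lam h := by
  cases lam with
  | inl f => cases h <;> exact le_rfl
  | inr J =>
    cases h with
    | inl z => exact le_rfl
    | inr z =>
      show 0 ≤ (kG i).l2 n J z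
      fin_cases n
      · exact l2Of_nonneg _ _
      · exact Real.iSup_nonneg fun _ => l2Of_nonneg _ _
      · exact Real.iSup_nonneg fun _ => l2Of_nonneg _ _
      · exact Real.iSup_nonneg fun _ => Real.iSup_nonneg fun _ => l2Of_nonneg _ _
      · exact Real.iSup_nonneg fun _ => Real.iSup_nonneg fun _ => l2Of_nonneg _ _
      · exact Real.iSup_nonneg fun _ => Real.iSup_nonneg fun _ => l2Of_nonneg _ _

/-! ## §2 The interface of the bundle to NODE 00 is jointly satisfiable (the zero operator layer) -/

section Interface

variable (𝔸 : Type) [NormedRing 𝔸] [NormedAlgebra ℂ 𝔸] [CompleteSpace 𝔸] (G : Subgroup 𝔸ˣ)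

/-- **THE INTERFACE HYPOTHESES OF `b9LeafX_carriersY` ARE JOINTLY SATISFIABLE** — witnessed by the ZERO operator layer (every functional `0`, every predicate `True`,
every kernel `0`): the eight `U = 1` comparisons hold because NODE 00's readings are nonnegative (§1), the null readings `hE4`∕`hH2` hold trivially, and the
layer's `G′` entries vanish identically.  A5 guard: an `∃ ops`-form of anything at this bundle is junk-inhabited; the content of N06 lives in the sixteen leaves
AT GENUINE operators. [cite: Balaban1985BackgroundPropagators, Thms 3.1–3.15 pp.397–432 (bookkeeping: non-vacuity of the typed interface at the Stage-3′(Y) carriers)] -/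
theorem exists_ops_interface :
    ∃ ops : ∀ x : MemberY d ℓ hd hL b₀ b₁ Mstar, OperatorLayerY d ℓ hd hL b₀ b₁ Mstar 𝔸 G x,
      (∀ (x : MemberY d ℓ hd hL b₀ b₁ Mstar) (n : Fin 4) (U : (bg9Y 𝔸 G x).Cfg) (lam : (geo9Y x).Loc) (y : (geo9Y x).Site),
        (ops x).Gp.e n U lam y = 0) ∧
      (∀ (x : MemberY d ℓ hd hL b₀ b₁ Mstar) (n : Fin 4) (lam : (geo9Y x).Loc) (y : (geo9Y x).Site),
        (ops x).Gp.e n (bg9Y 𝔸 G x).one lam y ≤ (Node00.GpU x.toKIdx).e n lam y) ∧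
      (∀ (x : MemberY d ℓ hd hL b₀ b₁ Mstar) (lam : (geo9Y x).Loc) (b : ℝ) (ζ : (geo9Y x).Cut),
        (ops x).Gp.h1 (bg9Y 𝔸 G x).one lam b ζ ≤ (Node00.GpU x.toKIdx).h1 lam b ζ) ∧
      (∀ (x : MemberY d ℓ hd hL b₀ b₁ Mstar) (y y' : (geo9Y x).Site),
        |(ops x).Cinv.ker (bg9Y 𝔸 G x).one y y'| ≤ |(Node00.CinvU x.toKIdx).ker y y'|) ∧
      (∀ (x : MemberY d ℓ hd hL b₀ b₁ Mstar) (n : Fin 4) (lam : (geo9Y x).Loc) (y : (geo9Y x).Site),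
        (ops x).GA.e n (bg9Y 𝔸 G x).one lam y ≤ (Node00.GU x.toKIdx).e n lam y) ∧
      (∀ (x : MemberY d ℓ hd hL b₀ b₁ Mstar) (lam : (geo9Y x).Loc) (b : ℝ) (ζ : (geo9Y x).Cut),
        (ops x).GA.h1 (bg9Y 𝔸 G x).one lam b ζ ≤ (Node00.GU x.toKIdx).h1 lam b ζ) ∧
      (∀ (x : MemberY d ℓ hd hL b₀ b₁ Mstar) (lam : (geo9Y x).Loc) (y : (geo9Y x).Site),
        (ops x).GA.e4 (bg9Y 𝔸 G x).one lam y ≤ (Node00.GU x.toKIdx).e4 lam y) ∧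
      (∀ (x : MemberY d ℓ hd hL b₀ b₁ Mstar) (lam : (geo9Y x).Loc) (b : ℝ) (ζ : (geo9Y x).Cut),
        (ops x).GA.h2 (bg9Y 𝔸 G x).one lam b ζ ≤ (Node00.GU x.toKIdx).h2 lam b ζ) ∧
      (∀ (x : MemberY d ℓ hd hL b₀ b₁ Mstar) (n : Fin 6) (lam : (geo9Y x).Loc) (h : (geo9Y x).Cut),
        (ops x).GA.l2 n (bg9Y 𝔸 G x).one lam h ≤ (Node00.GU x.toKIdx).l2 n lam h) ∧
      (∀ (x : MemberY d ℓ hd hL b₀ b₁ Mstar) (lam : (geo9Y x).Loc), ¬ (lam.isRight = true) →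
        ∀ y, (ops x).GA.e4 (bg9Y 𝔸 G x).one lam y ≤ 0) ∧
      (∀ (x : MemberY d ℓ hd hL b₀ b₁ Mstar) (lam : (geo9Y x).Loc), ¬ (lam.isRight = true) →
        ∀ (β : ℝ) (ζ : (geo9Y x).Cut), (ops x).GA.h2 (bg9Y 𝔸 G x).one lam β ζ ≤ 0) := by
  refine ⟨fun x =>
    { Gp := ⟨fun _ _ _ _ => 0, fun _ _ _ _ => 0, fun _ _ _ => 0, fun _ _ _ _ => 0, fun _ _ _ _ => 0, fun _ _ _ _ => 0⟩
      GA := ⟨fun _ _ _ _ => 0, fun _ _ _ _ => 0, fun _ _ _ => 0, fun _ _ _ _ => 0, fun _ _ _ _ => 0, fun _ _ _ _ => 0⟩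
      Cinv := ⟨fun _ _ _ => 0⟩
      IsAnalyticExt := fun _ _ _ => True
      E37 := { Walk := PUnit, wlen := fun _ => 0, first := fun _ _ => True, last := fun _ _ => True, wdist := fun _ _ _ => 0,
               term := fun _ _ _ _ => 0, LocDep := fun _ _ => True, Converges := fun _ => True }
      EK39 := { Walk := PUnit, wlen := fun _ => 0, wdist := fun _ _ _ => 0, kterm := fun _ _ _ _ => 0, LocDep := fun _ _ => True,
                Converges := fun _ => True }
      E310 := { Walk := PUnit, wlen := fun _ => 0, first := fun _ _ => True, last := fun _ _ => True, wdist := fun _ _ _ => 0,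
                term := fun _ _ _ _ => 0, LocDep := fun _ _ => True, Converges := fun _ => True }
      PosDef := fun _ _ => True
      GD := ⟨fun _ _ _ _ => 0, fun _ _ _ _ => 0, fun _ _ _ => 0, fun _ _ _ _ => 0, fun _ _ _ _ => 0, fun _ _ _ _ => 0⟩
      G₁ := ⟨fun _ _ _ _ => 0, fun _ _ _ _ => 0, fun _ _ _ => 0, fun _ _ _ _ => 0, fun _ _ _ _ => 0, fun _ _ _ _ => 0⟩
      H := { e := fun _ _ _ _ => 0, h := fun _ _ _ _ => 0 }
      H₁ := { e := fun _ _ _ _ => 0, h := fun _ _ _ _ => 0 }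
      HasRWExp := fun _ _ _ => True
      HasRWExpH := fun _ _ _ => True
      PosDefK := fun _ _ => True
      GG := ⟨fun _ _ _ _ => 0, fun _ _ _ _ => 0, fun _ _ _ => 0, fun _ _ _ _ => 0, fun _ _ _ _ => 0, fun _ _ _ _ => 0⟩
      Kdiff := ⟨fun _ _ _ _ => 0, fun _ _ _ _ => 0, fun _ _ _ => 0, fun _ _ _ _ => 0, fun _ _ _ _ => 0, fun _ _ _ _ => 0⟩
      Ck := ⟨fun _ _ _ => 0⟩
      GivenBy3185 := fun _ => True
      HasRWExpC := fun _ _ => True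
      P349 := ⟨fun _ _ _ _ => 0⟩
      QGQinv := ⟨fun _ _ _ => 0⟩
      QG1Qinv := ⟨fun _ _ _ => 0⟩ }, ?_, ?_, ?_, ?_, ?_, ?_, ?_, ?_, ?_, ?_, ?_⟩
  · intro _ _ _ _ _; rfl
  · intro x n lam y; exact GpU_e_nonneg x.toKIdx n lam y
  · intro x lam b ζ; exact GpU_h1_nonneg x.toKIdx lam b ζ
  · intro x y y'; simp only [abs_zero]; exact abs_nonneg _
  · intro x n lam y; exact GU_e_nonneg x.toKIdx n lam y
  · intro x lam b ζ; exact GU_h1_nonneg x.toKIdx lam b ζ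
  · intro x lam y; exact GU_e4_nonneg x.toKIdx lam y
  · intro x lam b ζ; exact GU_h2_nonneg x.toKIdx lam b ζ
  · intro x n lam h; exact GU_l2_nonneg x.toKIdx n lam h
  · intro _ _ _ _; exact le_rfl
  · intro _ _ _ _ _; exact le_rfl

end Interface

/-! ## §3 The sixteen leaves, the residual entries and the Sect. B step at the ZERO operator layer over the REAL geometry: every clause is `0 ≤ (nonnegative right-hand side)` -/

section ZeroLeaves

open B9FromB6ModelSignsOn (ModelSignsOn)

variable {g : B9.Geometry} {B : B9.Backgrounds} {P : g.Loc → Prop}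

/-- `[(Lʲη)², Lʲη, Lʲη, 1]_n ≥ 0`. [cite: Balaban1985BackgroundPropagators, (3.42) p.397 (bookkeeping)] -/
private theorem pref4_nonneg' {t : ℝ} (ht : 0 ≤ t) (n : Fin 4) : 0 ≤ B9.pref4 t n := by
  fin_cases n <;> simp [B9.pref4, ht]

/-- `[(Lʲη)², Lʲη, Lʲη, 1, 1, 1]_n ≥ 0`. [cite: Balaban1985BackgroundPropagators, (3.46) p.398 (bookkeeping)] -/
private theorem pref6_nonneg' {t : ℝ} (ht : 0 ≤ t) (n : Fin 6) : 0 ≤ B9.pref6 t n := by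
  fin_cases n <;> simp [B9.pref6, ht]

/-- `[1, (Lʲη)⁻¹, (Lʲη)⁻¹, (Lʲη)⁻²]_n ≥ 0`. [cite: Balaban1985BackgroundPropagators, (3.49) p.399 (bookkeeping)] -/
private theorem pref4inv_nonneg' {t : ℝ} (ht : 0 ≤ t) (n : Fin 4) : 0 ≤ B9.pref4inv t n := by
  fin_cases n <;> simp [B9.pref4inv, ht, inv_nonneg]

/-- the walk factor of (3.94)∕(3.99)∕(3.108) is ≥ 0 for nonnegative constants and `M ≥ 0`. [cite: Balaban1985BackgroundPropagators, (3.94) p.410 (bookkeeping)] -/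
private theorem walkFactor_nonneg' {C c M : ℝ} (hC : 0 ≤ C) (hc : 0 ≤ c) (hM : 0 ≤ M) (δ₀ : ℝ) (n : ℕ) (dω : ℝ) :
    0 ≤ B9.walkFactor C c M δ₀ n dω :=
  mul_nonneg (mul_nonneg (mul_nonneg hC (pow_nonneg (mul_nonneg hc (Real.rpow_nonneg hM _)) n)) (Real.rpow_nonneg hM _))
    (Real.exp_nonneg _)

/-- (3.42)+(3.46)+(3.47) at the zero family: `0 ≤` the printed right-hand sides. [cite: Balaban1985BackgroundPropagators, (3.42)–(3.47) pp.397–398 (bookkeeping: vacuity of the bounds at the zero operators)] -/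
private theorem ineq342_zero (S : ModelSignsOn g P) {B₀ : ℝ} (hB₀ : 0 ≤ B₀) (δ₀ : ℝ) (U : B.Cfg) :
    B9.Ineq342_346_347 (⟨fun _ _ _ _ => 0, fun _ _ _ _ => 0, fun _ _ _ => 0, fun _ _ _ _ => 0, fun _ _ _ _ => 0, fun _ _ _ _ => 0⟩ : B9.KernelFamily g B)
      B₀ δ₀ U := by
  refine ⟨?_, ?_, ?_⟩
  · intro n lam y y' _
    exact mul_nonneg (mul_nonneg (mul_nonneg hB₀ (pref4_nonneg' (S.len_nonneg y) n)) (Real.exp_nonneg _)) (S.supNorm_nonneg lam)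
  · intro n lam h y y' _ _
    exact mul_nonneg (mul_nonneg (mul_nonneg (mul_nonneg hB₀ (pref6_nonneg' (S.len_nonneg y) n)) (S.cutSup_nonneg h)) (Real.exp_nonneg _))
      (S.l2Norm_nonneg lam)
  · intro n lam γ _ _
    exact mul_nonneg hB₀ (S.wNorm_nonneg γ lam)

/-- (3.43)–(3.45) at the zero family. [cite: Balaban1985BackgroundPropagators, (3.43)–(3.45) p.398 (bookkeeping)] -/
private theorem ineq343_zero (S : ModelSignsOn g P) {Bβ Bε : ℝ → ℝ} {Bεβ : ℝ → ℝ → ℝ} (hβ : ∀ b, 0 ≤ Bβ b) (hε : ∀ e, 0 ≤ Bε e)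
    (hεβ : ∀ e b, 0 ≤ Bεβ e b) (δ₀ : ℝ) (U : B.Cfg) :
    B9.Ineq343_345 (⟨fun _ _ _ _ => 0, fun _ _ _ _ => 0, fun _ _ _ => 0, fun _ _ _ _ => 0, fun _ _ _ _ => 0, fun _ _ _ _ => 0⟩ : B9.KernelFamily g B)
      Bβ Bε Bεβ δ₀ U := by
  refine ⟨?_, ?_, ?_⟩
  · intro β lam ζ y y' _ _ _ _
    exact mul_nonneg (mul_nonneg (mul_nonneg (mul_nonneg (hβ β) (Real.rpow_nonneg (S.len_nonneg y) _)) (S.cutH_nonneg β ζ)) (Real.exp_nonneg _))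
      (S.supNorm_nonneg lam)
  · intro ε lam y y' _ _ _
    exact mul_nonneg (mul_nonneg (hε ε) (Real.exp_nonneg _)) (add_nonneg (S.holder_nonneg ε lam) (S.supNorm_nonneg lam))
  · intro ε β lam ζ y y' _ _ _ _ _ _
    exact mul_nonneg (mul_nonneg (mul_nonneg (mul_nonneg (hεβ ε β) (Real.rpow_nonneg (S.len_nonneg y) _)) (S.cutH_nonneg β ζ))
      (Real.exp_nonneg _)) (add_nonneg (S.holder_nonneg _ lam) (S.supNorm_nonneg lam))

/-- the (3.48)∕(3.132)-type kernel bounds at the zero kernel. [cite: Balaban1985BackgroundPropagators, (3.48) p.398 (bookkeeping)] -/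
private theorem kernel_zero (S : ModelSignsOn g P) (dd : ℕ) {B₁ : ℝ} (hB₁ : 0 ≤ B₁) (p δ : ℝ) (U : B.Cfg) (y y' : g.Site) :
    |(⟨fun _ _ _ => 0⟩ : B9.SiteKernel g B).ker U y y'| ≤ B₁ * g.len y ^ p * g.len y' ^ (-(dd : ℝ)) * Real.exp (-(δ * g.dist y y')) := by
  rw [show (⟨fun _ _ _ => 0⟩ : B9.SiteKernel g B).ker U y y' = 0 from rfl, abs_zero]
  exact mul_nonneg (mul_nonneg (mul_nonneg hB₁ (Real.rpow_nonneg (S.len_nonneg y) _)) (Real.rpow_nonneg (S.len_nonneg y') _)) (Real.exp_nonneg _)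

/-- «Theorems 3.1–3.3 hold» at the zero operators with all constants `1`. [cite: Balaban1985BackgroundPropagators, Thms 3.1–3.3 pp.397–399 (bookkeeping)] -/
private theorem thmsAt_zero (S : ModelSignsOn g P) (dd : ℕ) (U : B.Cfg) :
    B9.Thms31to33IneqAt dd
      (⟨fun _ _ _ _ => 0, fun _ _ _ _ => 0, fun _ _ _ => 0, fun _ _ _ _ => 0, fun _ _ _ _ => 0, fun _ _ _ _ => 0⟩ : B9.KernelFamily g B)
      (⟨fun _ _ _ _ => 0, fun _ _ _ _ => 0, fun _ _ _ => 0, fun _ _ _ _ => 0, fun _ _ _ _ => 0, fun _ _ _ _ => 0⟩ : B9.KernelFamily g B)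
      (⟨fun _ _ _ => 0⟩ : B9.SiteKernel g B) 1 1 (fun _ => 1) (fun _ => 1) (fun _ _ => 1) 1 1 U :=
  ⟨⟨ineq342_zero S zero_le_one 1 U, ineq343_zero S (fun _ => zero_le_one) (fun _ => zero_le_one) (fun _ _ => zero_le_one) 1 U⟩,
    fun y y' => kernel_zero S dd zero_le_one _ 1 U y y',
    ⟨ineq342_zero S zero_le_one 1 U, ineq343_zero S (fun _ => zero_le_one) (fun _ => zero_le_one) (fun _ _ => zero_le_one) 1 U⟩⟩

/-- (3.133) at the zero `H`-kernel. [cite: Balaban1985BackgroundPropagators, (3.133) p.422 (bookkeeping)] -/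
private theorem ineq3133_zero (S : ModelSignsOn g P) (dd : ℕ) (U : B.Cfg) :
    B9.Ineq3133 dd ({ e := fun _ _ _ _ => 0, h := fun _ _ _ _ => 0 } : B9.HKernel g B) 1 (fun _ => 1) 1 U := by
  refine ⟨?_, ?_⟩
  · intro n y y'
    exact mul_nonneg (mul_nonneg (mul_nonneg zero_le_one (Real.rpow_nonneg (S.len_nonneg y) _)) (Real.rpow_nonneg (S.len_nonneg y') _))
      (Real.exp_nonneg _)
  · intro β ζ y y' _ _ _
    exact mul_nonneg (mul_nonneg (mul_nonneg (mul_nonneg zero_le_one (S.cutH_nonneg β ζ)) (Real.rpow_nonneg (S.len_nonneg y) _))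
      (Real.rpow_nonneg (S.len_nonneg y') _)) (Real.exp_nonneg _)

/-- (3.49) at the zero fine kernel. [cite: Balaban1985BackgroundPropagators, (3.49) p.399 (bookkeeping)] -/
private theorem ineq349_zero (S : ModelSignsOn g P) (dd : ℕ) (U : B.Cfg) : B9.Ineq349 dd (⟨fun _ _ _ _ => 0⟩ : B9.FineKernel g B) 1 1 U := by
  intro n y y'
  exact mul_nonneg (mul_nonneg (mul_nonneg zero_le_one (pref4inv_nonneg' (S.len_nonneg y) n)) (Real.rpow_nonneg (S.len_nonneg y') _))
    (Real.exp_nonneg _)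

/-- the residual entry blocks of `B9FromB6` at the zero family. [cite: Balaban1985BackgroundPropagators, Cor. 3.5 p.407 (bookkeeping)] -/
private theorem residual_zero (S : ModelSignsOn g P) (U : B.Cfg) :
    B9FromB6.L2Block (⟨fun _ _ _ _ => 0, fun _ _ _ _ => 0, fun _ _ _ => 0, fun _ _ _ _ => 0, fun _ _ _ _ => 0, fun _ _ _ _ => 0⟩ : B9.KernelFamily g B) 1 1 U ∧
    B9FromB6.GlobBlock (⟨fun _ _ _ _ => 0, fun _ _ _ _ => 0, fun _ _ _ => 0, fun _ _ _ _ => 0, fun _ _ _ _ => 0, fun _ _ _ _ => 0⟩ : B9.KernelFamily g B) 1 U ∧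
    B9FromB6.H1Block (⟨fun _ _ _ _ => 0, fun _ _ _ _ => 0, fun _ _ _ => 0, fun _ _ _ _ => 0, fun _ _ _ _ => 0, fun _ _ _ _ => 0⟩ : B9.KernelFamily g B) (fun _ => 1) 1 U ∧
    B9FromB6.E4Block (⟨fun _ _ _ _ => 0, fun _ _ _ _ => 0, fun _ _ _ => 0, fun _ _ _ _ => 0, fun _ _ _ _ => 0, fun _ _ _ _ => 0⟩ : B9.KernelFamily g B) (fun _ => 1) 1 U ∧
    B9FromB6.H2Block (⟨fun _ _ _ _ => 0, fun _ _ _ _ => 0, fun _ _ _ => 0, fun _ _ _ _ => 0, fun _ _ _ _ => 0, fun _ _ _ _ => 0⟩ : B9.KernelFamily g B) (fun _ _ => 1) 1 U := by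
  obtain ⟨h1, h2, h3⟩ := ineq342_zero (B := B) S zero_le_one 1 U
  obtain ⟨h4, h5, h6⟩ := ineq343_zero (B := B) S (Bβ := fun _ => 1) (Bε := fun _ => 1) (Bεβ := fun _ _ => 1)
    (fun _ => zero_le_one) (fun _ => zero_le_one) (fun _ _ => zero_le_one) 1 U
  refine ⟨h2, h3, ?_, ?_, ?_⟩
  · intro β lam ζ y y' hβ0 hβ1 _ hs
    exact mul_nonneg (mul_nonneg (mul_nonneg (mul_nonneg zero_le_one (Real.rpow_nonneg (S.len_nonneg y) _)) (S.cutH_nonneg β ζ)) (Real.exp_nonneg _))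
      (S.supNorm_nonneg lam)
  · intro ε lam y y' _ _ _
    exact mul_nonneg (mul_nonneg zero_le_one (Real.exp_nonneg _)) (add_nonneg (S.holder_nonneg ε lam) (S.supNorm_nonneg lam))
  · intro ε β lam ζ y y' _ _ _ _ _ _
    exact mul_nonneg (mul_nonneg (mul_nonneg (mul_nonneg zero_le_one (Real.rpow_nonneg (S.len_nonneg y) _)) (S.cutH_nonneg β ζ))
      (Real.exp_nonneg _)) (add_nonneg (S.holder_nonneg _ lam) (S.supNorm_nonneg lam))

/-- Thm 3.14's local blocks at the zero family (restriction `Q`, extra factor `e^{−1·F}` ≥ 0). [cite: Balaban1985BackgroundPropagators, Thm 3.14 pp.426–427 (bookkeeping)] -/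
private theorem local314_zero (S : ModelSignsOn g P) (Q : g.Site → Prop) (F : g.Site → g.Site → ℝ) (U : B.Cfg) :
    B9Thm314.IneqSupF (⟨fun _ _ _ _ => 0, fun _ _ _ _ => 0, fun _ _ _ => 0, fun _ _ _ _ => 0, fun _ _ _ _ => 0, fun _ _ _ _ => 0⟩ : B9.KernelFamily g B) 1 1 Q
        (fun y y' => Real.exp (-(1 * F y y'))) U ∧
    B9Thm314.IneqL2F (⟨fun _ _ _ _ => 0, fun _ _ _ _ => 0, fun _ _ _ => 0, fun _ _ _ _ => 0, fun _ _ _ _ => 0, fun _ _ _ _ => 0⟩ : B9.KernelFamily g B) 1 1 Q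
        (fun y y' => Real.exp (-(1 * F y y'))) U ∧
    B9Thm314.IneqHolderF (⟨fun _ _ _ _ => 0, fun _ _ _ _ => 0, fun _ _ _ => 0, fun _ _ _ _ => 0, fun _ _ _ _ => 0, fun _ _ _ _ => 0⟩ : B9.KernelFamily g B)
        (fun _ => 1) (fun _ => 1) (fun _ _ => 1) 1 Q (fun y y' => Real.exp (-(1 * F y y'))) U := by
  refine ⟨?_, ?_, ?_, ?_, ?_⟩
  · intro n lam y y' _ _ _
    exact mul_nonneg (mul_nonneg (mul_nonneg (mul_nonneg zero_le_one (pref4_nonneg' (S.len_nonneg y) n)) (Real.exp_nonneg _)) (Real.exp_nonneg _))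
      (S.supNorm_nonneg lam)
  · intro n lam h y y' _ _ _ _
    exact mul_nonneg (mul_nonneg (mul_nonneg (mul_nonneg (mul_nonneg zero_le_one (pref6_nonneg' (S.len_nonneg y) n)) (S.cutSup_nonneg h))
      (Real.exp_nonneg _)) (Real.exp_nonneg _)) (S.l2Norm_nonneg lam)
  · intro β lam ζ y y' _ _ _ _ _ _
    exact mul_nonneg (mul_nonneg (mul_nonneg (mul_nonneg (mul_nonneg zero_le_one (Real.rpow_nonneg (S.len_nonneg y) _)) (S.cutH_nonneg β ζ))
      (Real.exp_nonneg _)) (Real.exp_nonneg _)) (S.supNorm_nonneg lam)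
  · intro ε lam y y' _ _ _ _ _
    exact mul_nonneg (mul_nonneg (mul_nonneg zero_le_one (Real.exp_nonneg _)) (Real.exp_nonneg _))
      (add_nonneg (S.holder_nonneg ε lam) (S.supNorm_nonneg lam))
  · intro ε β lam ζ y y' _ _ _ _ _ _ _ _
    exact mul_nonneg (mul_nonneg (mul_nonneg (mul_nonneg (mul_nonneg zero_le_one (Real.rpow_nonneg (S.len_nonneg y) _)) (S.cutH_nonneg β ζ))
      (Real.exp_nonneg _)) (Real.exp_nonneg _)) (add_nonneg (S.holder_nonneg _ lam) (S.supNorm_nonneg lam))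

end ZeroLeaves

/-! ## §4 The whole knit at the bundle fires at the zero operator layer: its displayed hypotheses are JOINTLY SATISFIABLE over the real geometry -/

section Whole

variable (𝔸 : Type) [NormedRing 𝔸] [NormedAlgebra ℂ 𝔸] [CompleteSpace 𝔸] [NormOneClass 𝔸] (G : Subgroup 𝔸ˣ)

/-- **A5 CERTIFICATE FOR `b9LeafX_carriersY`**: at the ZERO operator layer EVERY displayed hypothesis of the knit at the bundle holds over the REAL geometry `geo9Y` ∕
backgrounds `bg9Y` — the eight `U = 1` comparisons (§2), the null readings, the residual entries, the Sect. B step, the gauge reduction (VACUOUSLY: `InCubeY` is empty,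
`not_inCubeY`), and the sixteen leaves (each bound `0 ≤` a product of nonnegative geometric quantities, §3) — so, GIVEN the [B6] block at NODE 00's tower block of
record (N03's content), the leaf `B9LeafX (carriersY 𝔸 G ops₀)` is INHABITED.  Reading: the knit at the bundle is not an ex-falso shell, AND the leaf at the bundle
carries no content until `ops` are Bałaban's operators (the ∃-dual is junk). [cite: Balaban1985BackgroundPropagators, Thms 3.1–3.15 pp.397–432 (bookkeeping: joint satisfiability of the knit's displayed hypotheses at the Stage-3′(Y) carriers)] -/
theorem exists_ops_b9LeafX (δ₀ : ℝ) {Jt Kt : Type} (tree : Jt → B6.TreeData) (loc : Kt → B6.LocalOp)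
    (h6 : B6BlockParam (Node00.towerBlockOfRecord d ℓ hd hL b₀ b₁ δ₀ tree loc)) :
    ∃ ops : ∀ x : MemberY d ℓ hd hL b₀ b₁ Mstar, OperatorLayerY d ℓ hd hL b₀ b₁ Mstar 𝔸 G x,
      (∀ (x : MemberY d ℓ hd hL b₀ b₁ Mstar) (n : Fin 4) (U : (bg9Y 𝔸 G x).Cfg) (lam : (geo9Y x).Loc) (y : (geo9Y x).Site),
        (ops x).Gp.e n U lam y = 0) ∧
      B9LeafX (carriersY d ℓ hd hL b₀ b₁ Mstar 𝔸 G ops) := by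
  -- the sign facts of the member's geometry (dag-n03-b's instance) and `M ≥ 0`
  have S : ∀ x : MemberY d ℓ hd hL b₀ b₁ Mstar, B9FromB6ModelSignsOn.ModelSignsOn (geo9Y x) (fun lam => lam.isRight = true) :=
    fun x => B9GeoNormsKLevelModelSignsV1.modelSignsOn_geo9K x.toKIdx
  have hM : ∀ x : MemberY d ℓ hd hL b₀ b₁ Mstar, 0 ≤ (geo9Y x).M := fun x => by
    rw [B9PinMembersKLevelV1.geo9Y_M]; positivity
  -- the ZERO operator layer
  let ops : ∀ x : MemberY d ℓ hd hL b₀ b₁ Mstar, OperatorLayerY d ℓ hd hL b₀ b₁ Mstar 𝔸 G x := fun x =>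
    { Gp := ⟨fun _ _ _ _ => 0, fun _ _ _ _ => 0, fun _ _ _ => 0, fun _ _ _ _ => 0, fun _ _ _ _ => 0, fun _ _ _ _ => 0⟩
      GA := ⟨fun _ _ _ _ => 0, fun _ _ _ _ => 0, fun _ _ _ => 0, fun _ _ _ _ => 0, fun _ _ _ _ => 0, fun _ _ _ _ => 0⟩
      Cinv := ⟨fun _ _ _ => 0⟩
      IsAnalyticExt := fun _ _ _ => True
      E37 := { Walk := PUnit, wlen := fun _ => 0, first := fun _ _ => True, last := fun _ _ => True, wdist := fun _ _ _ => 0,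
               term := fun _ _ _ _ => 0, LocDep := fun _ _ => True, Converges := fun _ => True }
      EK39 := { Walk := PUnit, wlen := fun _ => 0, wdist := fun _ _ _ => 0, kterm := fun _ _ _ _ => 0, LocDep := fun _ _ => True,
                Converges := fun _ => True }
      E310 := { Walk := PUnit, wlen := fun _ => 0, first := fun _ _ => True, last := fun _ _ => True, wdist := fun _ _ _ => 0,
                term := fun _ _ _ _ => 0, LocDep := fun _ _ => True, Converges := fun _ => True }
      PosDef := fun _ _ => True
      GD := ⟨fun _ _ _ _ => 0, fun _ _ _ _ => 0, fun _ _ _ => 0, fun _ _ _ _ => 0, fun _ _ _ _ => 0, fun _ _ _ _ => 0⟩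
      G₁ := ⟨fun _ _ _ _ => 0, fun _ _ _ _ => 0, fun _ _ _ => 0, fun _ _ _ _ => 0, fun _ _ _ _ => 0, fun _ _ _ _ => 0⟩
      H := { e := fun _ _ _ _ => 0, h := fun _ _ _ _ => 0 }
      H₁ := { e := fun _ _ _ _ => 0, h := fun _ _ _ _ => 0 }
      HasRWExp := fun _ _ _ => True
      HasRWExpH := fun _ _ _ => True
      PosDefK := fun _ _ => True
      GG := ⟨fun _ _ _ _ => 0, fun _ _ _ _ => 0, fun _ _ _ => 0, fun _ _ _ _ => 0, fun _ _ _ _ => 0, fun _ _ _ _ => 0⟩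
      Kdiff := ⟨fun _ _ _ _ => 0, fun _ _ _ _ => 0, fun _ _ _ => 0, fun _ _ _ _ => 0, fun _ _ _ _ => 0, fun _ _ _ _ => 0⟩
      Ck := ⟨fun _ _ _ => 0⟩
      GivenBy3185 := fun _ => True
      HasRWExpC := fun _ _ => True
      P349 := ⟨fun _ _ _ _ => 0⟩
      QGQinv := ⟨fun _ _ _ => 0⟩
      QG1Qinv := ⟨fun _ _ _ => 0⟩ }
  refine ⟨ops, fun _ _ _ _ _ => rfl, ?_⟩
  refine B9PinCarriersKLevelV1.b9LeafX_carriersY ops δ₀ tree loc ?_ ?_ ?_ ?_ ?_ ?_ ?_ ?_ ?_ ?_ ?_ ?_ ?_ ?_ ?_ ?_ ?_ ?_ ?_ ?_ ?_ ?_ ?_ ?_ ?_ ?_ ?_ ?_ h6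
  -- the eight `U = 1` comparisons (§1) and the null readings
  · intro x n lam y; exact GpU_e_nonneg x.toKIdx n lam y
  · intro x lam b ζ; exact GpU_h1_nonneg x.toKIdx lam b ζ
  · intro x y y'; show |(0 : ℝ)| ≤ _; rw [abs_zero]; exact abs_nonneg _
  · intro x n lam y; exact GU_e_nonneg x.toKIdx n lam y
  · intro x lam b ζ; exact GU_h1_nonneg x.toKIdx lam b ζ
  · intro x lam y; exact GU_e4_nonneg x.toKIdx lam y
  · intro x lam b ζ; exact GU_h2_nonneg x.toKIdx lam b ζ
  · intro x n lam h; exact GU_l2_nonneg x.toKIdx n lam h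
  · intro _ _ _ _; exact le_rfl
  · intro _ _ _ _ _; exact le_rfl
  -- the residual entries
  · exact ⟨1, 1, 1, fun _ => 1, fun _ => 1, fun _ _ => 1, one_pos, one_pos, one_pos, fun x _ => residual_zero (S x) _⟩
  · exact ⟨1, 1, one_pos, one_pos, fun x _ => (residual_zero (S x) _).2.1⟩
  -- the Sect. B step (every slot of «Theorems 3.1–3.3 hold» at the zero operators)
  · intro B₀ δ₀' Bβ Bε Bεβ B₁ δ₁
    exact ⟨1, 1, 1, 1, 1, fun _ => 1, fun _ => 1, fun _ _ => 1, 1, 1, one_pos, one_pos, one_pos, one_pos, one_pos, one_pos, one_pos,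
      fun x _ α₀ _ _ U _ _ α₁ _ _ => ⟨trivial, trivial, fun U' _ => thmsAt_zero (S x) _ _⟩⟩
  -- the gauge reduction: VACUOUS — no member lies in a class cube (`not_inCubeY`)
  · exact fun x hx => absurd hx (B9PinGeometryKLevelV1.not_inCubeY x)
  -- Thm 3.7 (convergence predicate `True`)
  · exact ⟨1, 1, one_pos, one_pos, fun _ _ _ _ _ _ _ => trivial⟩
  -- Cor 3.8: `0 ≤ (Lʲη)² · walkFactor · |λ|`
  · refine ⟨1, 1, 1, 1, 1, one_pos, one_pos, one_pos, one_pos, one_pos, fun x _ α₀ _ _ U _ ω lam y y' _ _ _ => ⟨trivial, ?_⟩⟩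
    exact mul_nonneg (mul_nonneg (pow_nonneg ((S x).len_nonneg y) 2) (walkFactor_nonneg' zero_le_one zero_le_one (hM x) _ _ _))
      ((S x).supNorm_nonneg lam)
  -- Thm 3.9: `|0| ≤ (Lʲη)^{−4}(L^{j′}η)^{−d}·walkFactor`
  · refine ⟨1, 1, 1, 1, 1, one_pos, one_pos, one_pos, one_pos, one_pos, fun x _ α₀ _ _ U _ => ⟨trivial, fun ω y y' => ⟨trivial, ?_⟩⟩⟩
    show |(0 : ℝ)| ≤ _
    rw [abs_zero]
    exact mul_nonneg (mul_nonneg (Real.rpow_nonneg ((S x).len_nonneg y) _) (Real.rpow_nonneg ((S x).len_nonneg y') _))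
      (walkFactor_nonneg' zero_le_one zero_le_one (hM x) _ _ _)
  -- Thm 3.10
  · refine ⟨1, 1, 1, 1, 1, one_pos, one_pos, one_pos, one_pos, one_pos, fun x _ α₀ _ _ U _ =>
      ⟨trivial, fun ω J y y' _ _ _ => ⟨trivial, ?_⟩⟩⟩
    exact mul_nonneg (mul_nonneg (pow_nonneg ((S x).len_nonneg y) 2) (walkFactor_nonneg' zero_le_one zero_le_one (hM x) _ _ _))
      ((S x).supNorm_nonneg J)
  -- the two summation leaves
  · exact ⟨1, 1, fun _ => 1, fun _ => 1, fun _ _ => 1, one_pos, one_pos, fun x U =>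
      ⟨fun _ => ⟨ineq342_zero (S x) zero_le_one 1 U, ineq343_zero (S x) (fun _ => zero_le_one) (fun _ => zero_le_one) (fun _ _ => zero_le_one) 1 U⟩,
       fun _ => ⟨ineq342_zero (S x) zero_le_one 1 U, ineq343_zero (S x) (fun _ => zero_le_one) (fun _ => zero_le_one) (fun _ _ => zero_le_one) 1 U⟩⟩⟩
  · exact ⟨1, 1, one_pos, one_pos, fun x U _ y y' => kernel_zero (S x) _ zero_le_one _ 1 U y y'⟩
  -- Thm 3.11 (positivity predicates `True`)
  · exact ⟨1, 1, one_pos, one_pos, fun _ _ _ _ _ _ _ _ => trivial⟩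
  -- Thm 3.12
  · refine ⟨1, 1, 1, 1, fun _ => 1, fun _ => 1, fun _ _ => 1, one_pos, one_pos, one_pos, one_pos, fun x _ α₀ _ _ U _ _ => ⟨?_, ?_⟩⟩
    · intro K' hK'
      simp only [List.mem_cons, List.not_mem_nil, or_false] at hK'
      rcases hK' with rfl | rfl <;>
        exact ⟨B9.noLap_of_full _ (ineq342_zero (S x) zero_le_one 1 U),
          ineq343_zero (S x) (fun _ => zero_le_one) (fun _ => zero_le_one) (fun _ _ => zero_le_one) 1 U, trivial, trivial⟩
    · intro H' hH'
      simp only [List.mem_cons, List.not_mem_nil, or_false] at hH'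
      rcases hH' with rfl | rfl <;> exact ⟨ineq3133_zero (S x) _ U, trivial⟩
  -- Thm 3.13
  · exact ⟨1, 1, 1, 1, fun _ => 1, fun _ => 1, fun _ _ => 1, one_pos, one_pos, one_pos, one_pos, fun x _ α₀ _ _ U _ _ =>
      ⟨B9.noLap_of_full _ (ineq342_zero (S x) zero_le_one 1 U),
        ineq343_zero (S x) (fun _ => zero_le_one) (fun _ => zero_le_one) (fun _ _ => zero_le_one) 1 U, trivial, trivial⟩⟩
  -- Thm 3.14 (unrestricted sup entries)
  · refine ⟨1, 1, 1, 1, one_pos, one_pos, one_pos, one_pos, fun x _ α₀ _ _ U _ => ?_⟩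
    intro n lam y y' _
    exact mul_nonneg (mul_nonneg (mul_nonneg (mul_nonneg zero_le_one (pref4_nonneg' ((S x).len_nonneg y) n)) (Real.exp_nonneg _))
      (Real.exp_nonneg _)) ((S x).supNorm_nonneg lam)
  -- Thm 3.15 (predicates `True`, kernel `0`)
  · refine ⟨1, 1, 1, one_pos, one_pos, one_pos, fun x α₀ _ _ U _ _ => ⟨trivial, trivial, fun y y' _ _ => ?_⟩⟩
    show |(0 : ℝ)| ≤ _
    rw [abs_zero]
    exact mul_nonneg zero_le_one (Real.exp_nonneg _)
  -- (3.49)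
  · exact ⟨1, 1, 1, 1, one_pos, one_pos, one_pos, one_pos, fun x _ α₀ _ _ U _ => ineq349_zero (S x) _ U⟩
  -- (3.132)
  · exact ⟨1, 1, 1, 1, one_pos, one_pos, one_pos, one_pos, fun x _ α₀ _ _ U _ _ =>
      ⟨fun y y' => kernel_zero (S x) _ zero_le_one _ 1 U y y', fun y y' => kernel_zero (S x) _ zero_le_one _ 1 U y y'⟩⟩
  -- Thm 3.14 local
  · refine ⟨1, 1, 1, 1, fun _ => 1, fun _ => 1, fun _ _ => 1, one_pos, one_pos, one_pos, one_pos, fun x _ α₀ _ _ U _ => ?_⟩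
    exact local314_zero (S x) _ _ U

end Whole

end Literature.MathematicalPhysics.QuantumFieldTheory.Balaban1983to89.B9PinCarriersNonVacuity

end
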